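import Literature.InformationTheory.QuantumCodes.MatchingDecodersExistence
import HarnessLib

/-!
# Weighted minimum-weight perfect matching: the Edmonds–Johnson theorem with non-negative INTEGER link weights
# (Korte–Vygen Lemma 12.8 / Thm 12.9 in the printed generality `c : E(G) → ℝ₊`, here `c : E → ℕ`)

Topic `Literature/InformationTheory/QuantumCodes` (venture QEC, LADDER-QEC Q5 «toric/surface + MWPM»; qec-type-09 gen 4, item
09.MWPM — closes the `TODO(general form)` of `MatchingCost.lean` / `MatchingDecoders.lean`, which treat unit link weights,
`hammingNorm`). Dennis–Kitaev–Landahl–Preskill's decoder for DIFFERENT qubit- and measurement-error rates weights the links: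
"we minimize the effective length (number of links) of the chain, but with horizontal and vertical links given different
linear weights for `p ≠ q`" (§5.1, eq. (weight): `H·log((1-p)/p) + V·log((1-q)/q)`). Korte–Vygen §12.2: for weights
`c : E(G) → ℝ₊`, "By Lemma 12.8, `c̄(M)` is at most the minimum weight of a `T`-join … `c(J) ≤ c̄(M)`, so `J` is optimum"
(proof of Thm 12.9). This file PROVES the integer-weighted version (0 facts, kernel axioms):

* `cWeight c e = Σ_{ℓ ∈ supp e} c ℓ` — the `c`-weight of a chain (`cWeight 1 = hammingNorm`, `cWeight_one`);
* `LinkMetric ι c` — a symmetric `ℕ`-valued weight `d` on pairs of sites with the triangle inequality and `d a b ≤ c ℓ`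
  across every link `ℓ` (the metric closure `c̄`); `toEdgeMetric` for `c = 1`;
* **`LinkMetric.exists_isPMOn_cost_le`** — every chain `e` pays for a perfect matching of `supp ∂e` of cost `≤ cWeight c e`
  (Korte–Vygen Lemma 12.8, weighted; link peeling + the matching surgery of `MatchingCost.lean`);
* `IsWMatchingDecoder m D` — MWPM for the weights `d` with `c`-geodesics (`∂γ = ` the ends, `cWeight c γ ≤ d a b`), and
  **`IsWMatchingDecoder.isMinWeight`**: `D.IsMinWeight (graphSyn ι) (graphCycles ι) (cWeight c)` — weighted MWPM IS
  minimum-`c`-weight decoding (Korte–Vygen Thm 12.9 / Edmonds–Johnson 1973).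

## References
* [KorteVygen2002] B. Korte, J. Vygen, *Combinatorial Optimization*, 2nd ed., Springer (2002), §12.2 Lemma 12.8, Thm 12.9
  (Edmonds–Johnson), pp. 276–277.
* [DennisEtAl2002] E. Dennis, A. Kitaev, A. Landahl, J. Preskill, *Topological quantum memory*, J. Math. Phys. 43 (2002)
  4452–4505, arXiv:quant-ph/0110143, §5.1 eq. (weight) (p ≠ q: weighted links).
-/

namespace Literature.InformationTheory.QuantumCodes

open Finset Matrix Literature.Barriers.PneNP
open scoped symmDiff

variable {V E : Type*}

/-! ### The weighted norm of a chain -/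

/-- The **`c`-weight of a chain**: `Σ_{ℓ ∈ supp e} c ℓ` ("horizontal and vertical links given different linear weights").
(definition) [cite: DennisEtAl2002, §5.1 eq. (weight)] -/
def cWeight [Fintype E] (c : E → ℕ) (e : E → ZMod 2) : ℕ :=
  ∑ ℓ ∈ supp e, c ℓ

/-- Unit weights give the Hamming weight. [cite: DennisEtAl2002, §5.1 (p = q: the number of links)] -/
theorem cWeight_one [Fintype E] (e : E → ZMod 2) : cWeight (fun _ => 1) e = hammingNorm e := by
  simp [cWeight]; rfl

/-- The `c`-weight of a sum is at most the sum of the `c`-weights. [cite: KorteVygen2002, §12.2 proof of Thm 12.9 (c(J) ≤ Σ c(E(Pᵢ)))] -/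
theorem cWeight_add_le [Fintype E] [DecidableEq E] (c : E → ℕ) (x y : E → ZMod 2) :
    cWeight c (x + y) ≤ cWeight c x + cWeight c y := by
  unfold cWeight
  calc ∑ ℓ ∈ supp (x + y), c ℓ ≤ ∑ ℓ ∈ supp x ∪ supp y, c ℓ :=
        sum_le_sum_of_subset_of_nonneg (supp_add_subset x y) fun _ _ _ => Nat.zero_le _
    _ ≤ ∑ ℓ ∈ supp x, c ℓ + ∑ ℓ ∈ supp y, c ℓ := by
        have h := Finset.sum_union_inter (s₁ := supp x) (s₂ := supp y) (f := c)
        omega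

/-- Subadditivity of the `c`-weight over a finite sum. [cite: KorteVygen2002, §12.2 proof of Thm 12.9 (c(J) ≤ c̄(M))] -/
theorem cWeight_sum_le [Fintype E] [DecidableEq E] (c : E → ℕ) {α : Type*} [DecidableEq α] (s : Finset α)
    (f : α → E → ZMod 2) : cWeight c (∑ i ∈ s, f i) ≤ ∑ i ∈ s, cWeight c (f i) := by
  induction s using Finset.induction_on with
  | empty => simp [cWeight]
  | insert a s ha ih =>
    rw [sum_insert ha, sum_insert ha]
    exact (cWeight_add_le c _ _).trans (Nat.add_le_add_left ih _)

/-! ### Link metrics for weighted links -/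

/-- A **link metric for the weights `c`**: a symmetric `ℕ`-valued weight on pairs of sites with the triangle inequality and
at most `c ℓ` across every link `ℓ` (the metric closure `c̄` of `(G, c)`). (definition)
[cite: KorteVygen2002, §12.2 proof of Thm 12.9 (metric closure (Ḡ, c̄) of (G, c))] -/
structure LinkMetric (ι : E → Sym2 V) (c : E → ℕ) where
  /-- the distance -/
  d : V → V → ℕ
  /-- symmetry -/
  symm : ∀ u v, d u v = d v u
  /-- triangle inequality -/
  triangle : ∀ u v w, d u w ≤ d u v + d v w
  /-- every link is at most as long as its weight -/
  ends_le : ∀ ℓ a b, ι ℓ = s(a, b) → d a b ≤ c ℓ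

namespace LinkMetric

variable {ι : E → Sym2 V} {c : E → ℕ} (m : LinkMetric ι c)

/-- **The underlying site metric** as an `EdgeMetric` over the EMPTY link type (its `ends_le_one` field is vacuous):
all cost bookkeeping and the matching-surgery lemma of `MatchingCost.lean` (which never mention the links) are reused
through this view instead of being restated. [cite: KorteVygen2002, §12.2 proof of Thm 12.9 (metric closure (Ḡ, c̄))] -/
def base (m : LinkMetric ι c) : EdgeMetric (fun ℓ : Empty => (ℓ.elim : Sym2 V)) :=
  ⟨m.d, m.symm, m.triangle, fun ℓ => ℓ.elim⟩

/-- `m.base.d = m.d`. [cite: KorteVygen2002, §12.2 proof of Thm 12.9] -/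
@[simp] theorem base_d (m : LinkMetric ι c) : m.base.d = m.d := rfl

/-- Unit weights: a link metric for `c = 1` is an `EdgeMetric` of `MatchingCost.lean`. [cite: KorteVygen2002, §12.2 proof of Thm 12.9] -/
def toEdgeMetric (m : LinkMetric ι (fun _ => 1)) : EdgeMetric ι :=
  ⟨m.d, m.symm, m.triangle, m.ends_le⟩

end LinkMetric

namespace LinkMetric

variable [DecidableEq V] {ι : E → Sym2 V} {c : E → ℕ} (m : LinkMetric ι c)

/-! ### Korte–Vygen Lemma 12.8: a perfect matching of the defects of cost at most the chain weight -/

/-- **Every chain pays for a perfect matching of its boundary.** For every chain `e` (set of links) the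
defect set `supp ∂e` admits a perfect matching `M` with `c̄(M) ≤ |e|` — the matching half of "`c̄(M)` is at
most the minimum weight of a `T`-join" (our proof peels the links of `e` one at a time and applies the
surgery lemma; Korte–Vygen decompose an optimum `T`-join into paths).
[cite: KorteVygen2002, §12.2 Lemma 12.8 and proof of Thm 12.9 ("c̄(M) is at most the minimum weight of a T-join")] -/
theorem exists_isPMOn_cost_le [Fintype V] [Fintype E] [DecidableEq E] (e : E → ZMod 2) :
    ∃ M, IsPMOn (supp (graphSyn ι e)) M ∧ m.base.cost M ≤ cWeight c e := by
  suffices h : ∀ (n : ℕ) (e : E → ZMod 2), hammingNorm e = n →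
      ∃ M, IsPMOn (supp (graphSyn ι e)) M ∧ m.base.cost M ≤ cWeight c e from h _ e rfl
  intro n
  induction n with
  | zero =>
    intro e he
    rw [hammingNorm_eq_zero] at he
    subst he
    refine ⟨∅, ?_, by simp [EdgeMetric.cost]⟩
    rw [graphSyn_zero, supp_zero]
    exact IsPMOn.empty
  | succ k ih =>
    intro e he
    -- pick a link `ℓ` of `e` and peel it off
    have hne : (supp e).Nonempty := by
      rw [← card_pos]
      change 0 < hammingNorm e
      omega
    obtain ⟨ℓ, hℓ⟩ := hne
    rw [mem_supp_iff] at hℓ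
    have h01 : ∀ y : ZMod 2, y = 0 ∨ y = 1 := by decide
    have heℓ : e ℓ = 1 := (h01 (e ℓ)).resolve_left hℓ
    set e' : E → ZMod 2 := e + Pi.single ℓ 1 with he'
    have hsupp : supp e' = (supp e).erase ℓ := by
      ext j
      rw [mem_erase, mem_supp_iff, mem_supp_iff, he', Pi.add_apply]
      by_cases hj : j = ℓ
      · subst hj
        rw [heℓ, Pi.single_eq_same]
        have h2 : (1 : ZMod 2) + 1 = 0 := by decide
        simp [h2]
      · rw [Pi.single_eq_of_ne hj, add_zero]
        simp [hj]
    have hcard : hammingNorm e' = k := by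
      change (supp e').card = k
      rw [hsupp, card_erase_of_mem (mem_supp_iff.2 hℓ)]
      change hammingNorm e - 1 = k
      omega
    obtain ⟨M₀, hM₀, hc₀⟩ := ih e' hcard
    have hcw : cWeight c e = cWeight c e' + c ℓ := by
      unfold cWeight
      rw [hsupp, sum_erase_add _ _ (mem_supp_iff.2 hℓ)]
    have hee : e = e' + Pi.single ℓ 1 := by rw [he', add_assoc, chain_add_self, add_zero]
    have hsyn : graphSyn ι e = graphSyn ι e' + pairIndicator (ι ℓ) := by
      rw [hee, graphSyn_add, graphSyn_single]
    obtain ⟨⟨a, b⟩, hq⟩ := Quot.exists_rep (ι ℓ)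
    change s(a, b) = ι ℓ at hq
    by_cases hab : a = b
    · subst hab
      rw [← hq, pairIndicator_diag, add_zero] at hsyn
      rw [hsyn]
      exact ⟨M₀, hM₀, hc₀.trans (by rw [hcw]; exact Nat.le_add_right _ _)⟩
    · rw [← hq] at hsyn
      obtain ⟨M, hM, hc⟩ := m.base.exists_isPMOn_symmDiff hM₀ hab
      refine ⟨M, ?_, ?_⟩
      · rwa [hsyn, supp_add_pairIndicator _ hab]
      · rw [hcw]
        exact hc.trans (Nat.add_le_add hc₀ (by rw [base_d]; exact m.ends_le ℓ a b hq.symm))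

/-- **Every chain joining two distinct sites has `c`-weight at least `d a b`.** [cite: KorteVygen2002, §12.2 (|T| = 2: T-joins and shortest paths)] -/
theorem d_le_cWeight [Fintype V] [Fintype E] [DecidableEq E] {a b : V} (hab : a ≠ b)
    {γ : E → ZMod 2} (hγ : graphSyn ι γ = pairIndicator s(a, b)) : m.d a b ≤ cWeight c γ := by
  obtain ⟨M, hM, hc⟩ := m.exists_isPMOn_cost_le γ
  rw [hγ, supp_pairIndicator hab] at hM
  rw [hM.eq_singleton_of_pair hab] at hc
  simpa [EdgeMetric.cost] using hc

end LinkMetric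

/-! ### Weighted matching decoders -/

section Decoders

variable [DecidableEq V] [Fintype E] {ι : E → Sym2 V}

/-- A **weighted (minimum-weight perfect) matching decoder** for the graphlike model `ι` with link weights `c` and metric `m`: on
every achievable syndrome `∂e` it outputs `Σ_{s(a,b) ∈ M} γ_{ab}` where `M` is SOME minimum-cost perfect
matching of the defect set `supp ∂e` and each `γ_{ab}` is SOME geodesic chain (`∂γ_{ab} = 1_a + 1_b`,
`cWeight c γ_{ab} ≤ d a b`) — any tie-breaking rule, any choice of shortest paths ("We consider the shortest
`x`-`y`-path in `G` for each `{x, y} ∈ M` … Let `J` be the symmetric difference of the edge sets of all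
these paths"). (definition) Dennis–Kitaev–Landahl–Preskill §4.4 p. 18: "the perfect matching algorithm of Edmonds". [cite: KorteVygen2002, §12.2 proof of Thm 12.9] -/
def IsWMatchingDecoder [Fintype V] {c : E → ℕ} (m : LinkMetric ι c) (D : Decoder (V → ZMod 2) (E → ZMod 2)) : Prop :=
  ∀ e : E → ZMod 2, ∃ M : Finset (Sym2 V), m.base.IsMinCostMatching (supp (graphSyn ι e)) M ∧
    ∃ γ : Sym2 V → E → ZMod 2,
      (∀ p ∈ M, graphSyn ι (γ p) = pairIndicator p ∧ cWeight c (γ p) ≤ m.base.pairCost p) ∧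
        D (graphSyn ι e) = ∑ p ∈ M, γ p

/-- **Weighted matching decoders are minimum-`c`-weight decoders** (Edmonds–Johnson via Korte–Vygen Thm 12.9): the
output has the observed boundary ("Evidently, `J` is a `T`-join") and no chain with that boundary is
lighter ("`c(J) ≤ c̄(M)`, so `J` is optimum", with Lemma 12.8). Hence every threshold / radius theorem of
the tree for the weighted notion `Decoder.IsMinWeight … (cWeight c)` applies to weighted MWPM (DKLP's decoder for `p ≠ q`).
(DKLP §4.4 p. 18.) [cite: KorteVygen2002, §12.2 Thm 12.9 (Edmonds and Johnson [1973])] -/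
theorem IsWMatchingDecoder.isMinWeight [Fintype V] [DecidableEq E] {c : E → ℕ} {m : LinkMetric ι c}
    {D : Decoder (V → ZMod 2) (E → ZMod 2)} (hD : IsWMatchingDecoder m D) :
    D.IsMinWeight (graphSyn ι) (graphCycles ι) (cWeight c) := by
  refine ⟨fun e => ?_, fun e => ?_⟩
  · obtain ⟨M, ⟨hM, -⟩, γ, hγ, hDe⟩ := hD e
    rw [add_mem_graphCycles_iff, hDe, graphSyn_sum]
    calc ∑ p ∈ M, graphSyn ι (γ p) = ∑ p ∈ M, pairIndicator p := sum_congr rfl fun p hp => (hγ p hp).1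
      _ = fun v => if v ∈ supp (graphSyn ι e) then 1 else 0 := hM.sum_pairIndicator
      _ = graphSyn ι e := indicator_supp _
  · obtain ⟨M, ⟨hM, hmin⟩, γ, hγ, hDe⟩ := hD e
    obtain ⟨M₁, hM₁, hc₁⟩ := m.exists_isPMOn_cost_le e
    rw [hDe]
    calc cWeight c (∑ p ∈ M, γ p) ≤ ∑ p ∈ M, cWeight c (γ p) := cWeight_sum_le c M γ
      _ ≤ ∑ p ∈ M, m.base.pairCost p := sum_le_sum fun p hp => (hγ p hp).2
      _ ≤ m.base.cost M₁ := hmin M₁ hM₁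
      _ ≤ cWeight c e := hc₁

/-- The output of a weighted matching decoder: its `c`-weight is at most the cost of any perfect matching of the defects, hence the minimum-cost of a
perfect matching of the defects, which equals the minimum weight of a chain with that boundary.
[cite: KorteVygen2002, §12.2 Thm 12.9 proof ("so J is optimum")] -/
theorem IsWMatchingDecoder.cWeight_le_cost [Fintype V] [DecidableEq E] {c : E → ℕ} {m : LinkMetric ι c}
    {D : Decoder (V → ZMod 2) (E → ZMod 2)} (hD : IsWMatchingDecoder m D) (e : E → ZMod 2) {M : Finset (Sym2 V)}
    (hM : IsPMOn (supp (graphSyn ι e)) M) : cWeight c (D (graphSyn ι e)) ≤ m.base.cost M := by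
  obtain ⟨M₀, ⟨-, hmin⟩, γ, hγ, hDe⟩ := hD e
  rw [hDe]
  calc cWeight c (∑ p ∈ M₀, γ p) ≤ ∑ p ∈ M₀, cWeight c (γ p) := cWeight_sum_le c M₀ γ
    _ ≤ ∑ p ∈ M₀, m.base.pairCost p := sum_le_sum fun p hp => (hγ p hp).2
    _ ≤ m.base.cost M := hmin M hM

/-- **Unit weights**: a weighted matching decoder for `c = 1` is a matching decoder of `MatchingDecoders.lean` (same data).
[cite: KorteVygen2002, §12.2 Thm 12.9] -/
theorem IsWMatchingDecoder.isMatchingDecoder_one [Fintype V] {m : LinkMetric ι (fun _ => 1)}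
    {D : Decoder (V → ZMod 2) (E → ZMod 2)} (hD : IsWMatchingDecoder m D) : IsMatchingDecoder m.toEdgeMetric D := by
  intro e
  obtain ⟨M, ⟨hM, hmin⟩, γ, hγ, hDe⟩ := hD e
  refine ⟨M, ⟨hM, hmin⟩, γ, fun p hp => ⟨(hγ p hp).1, ?_⟩, hDe⟩
  have := (hγ p hp).2
  rwa [cWeight_one] at this

end Decoders

end Literature.InformationTheory.QuantumCodes
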